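import Mathlib
import Summits.ValiantsHypothesis.ValiantsHypothesis.Theses.FifoMatching
import Summits.ValiantsHypothesis.ValiantsHypothesis.Theorems.FifoMatchingNFPolytopeQueueGridPPHardOfCorGridMinor
import Summits.ValiantsHypothesis.ValiantsHypothesis.Theorems.FifoMatchingNFPolytopeQueueGridFaceProjection
import Literature.Combinatorics.Optimization.CorrelationPolytopeGridMinor
import HarnessLib

/-!
# K1: `Theses.FifoMatching.NFPolytopeQuasiPolyXC` holds, conditionally on ONE print fact (AFHMS 2019, Theorem 6)

Closer (c1 g5, director-valiant R157 (a)) of the support item stmt-ValiantsHypothesis-26254 of route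
`ValiantsHypothesis/FifoMatching` — K1 of the 21181-side plan of record, line
`Cruxes/NNLinearDegreeCofactorHard/Lines/queue_grid_face.lean` (val-idea-7 g6/g7; crit-3 VERDICT #18/#18b).

`nfPolytopeQuasiPolyXC_of_AboulkerEtAl2019 : AboulkerEtAl2019_corGridMinor → NFPolytopeQuasiPolyXC`:
THE NEST-FREE PERFECT-MATCHING POLYTOPE `NFP(2n) = Newt(NN_n)` HAS SUPER-QUASI-POLYNOMIAL EXTENSION COMPLEXITY — for every
`c`, for all large `n`, every slack-form extended formulation of `NFP(2n)` has more than `2^((log₂ n + c)^c)` inequalities —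
CONDITIONAL on the named Literature fact `Literature.Combinatorics.Optimization.AboulkerEtAl2019_corGridMinor`
(Aboulker–Fiorini–Huynh–Macchia–Seif, Oper. Res. Lett. 47 (2019), Theorem 6 / remark p. 4: a graph with a `G_{h,h}` minor
has `xc(COR(G)) ≥ 2^{c h}`; typed by val-lit-p9, p615264).  In fact the chain gives `xc(NFP(2n)) ≥ 2^{Ω(√n)}`.

Chain (all kernel-checked, in the tree):
* input (A) `NFPolytopeQuasiPolyXC.QueueGridFace.queueGridFaceProjection` (val-width-26254-qg1 g0,
  `Theorems/FifoMatchingNFPolytopeQueueGridFaceProjection.lean` + its Gadget* files; convex/FIFO glue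
  `QueueGridFace.face_projection_of_gadget_prop` p612281 / `eq_of_forall_lt_iff` p612984): a coordinate face of `NFP(2n)`
  projects EXACTLY onto the pair-pattern polytope `PP_r` of the `r × r` queue grid, `n ≥ (r+1)(2r+1)` (layout B, rigidity);
* input (B) `QueueGridFace.queueGridPPHard_of_AboulkerEtAl2019` (p615913 ← B♯ glue p615220, val-idea-7 g7's
  `Lines/queue_grid_face_bsharp.lean` ported: `grid_{⌊r/2⌋} ⊆ QG_r`, `COR(grid) =` linear image of `PP_r`,
  `HasEFOfSize.image_linear`, growth);
* assembly `QueueGridFace.newtXC_of_inputs` (p615400 ← val-idea-7 g6's `nfp_xc_of_queueGrid`: `r = ⌊√n⌋/2 − 1`, face by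
  `HasEFOfSize.inter_eqs`, projection by `HasEFOfSize.image_comp`, `log₂ n ≤ 2 log₂ r + 5`).
The route decl inlines `newt` / `nestFreeMatchingPoly n ℝ≥0` verbatim (`rfl`), whence the final `exact`.

Honesty: this closes K1 ONLY CONDITIONALLY on the print fact (census: one open Literature fact with a consumer); HD-1
(stmt-26253, `hd1_of_xc_qp` ∘ P1′) is the next consumer; `NNDivisionHard` (stmt-21181) and its RESIDUAL are untouched;
stmt-23918 / 24468 CLOSED, untouched; VP ≠ VNP is NOT moved (monotone / polyhedral world, FRONTIER currency).
-/

-- Sub = Summit single-conjunct layout: the duplicated namespace component is mandated by the tree.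
set_option linter.dupNamespace false

namespace Summit.ValiantsHypothesis.ValiantsHypothesis.Theorems.FifoMatching.QueueGridFace

/-- **K1, conditional on AFHMS 2019.**  `NFP(2n)` has super-quasi-polynomial extension complexity, assuming the named
print fact `AboulkerEtAl2019_corGridMinor` (xc of the correlation polytope of a graph with a `G_{h,h}` minor is
`≥ 2^{c h}`).  Inputs: (A) qg1's `queueGridFaceProjection`, (B) `queueGridPPHard_of_AboulkerEtAl2019`, assembly
`newtXC_of_inputs`. [cite: AboulkerEtAl2019, Theorem 6; FioriniEtAl2015, Lemma 9] -/
theorem nfPolytopeQuasiPolyXC_of_AboulkerEtAl2019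
    (hyp : Literature.Combinatorics.Optimization.AboulkerEtAl2019_corGridMinor) :
    Summit.ValiantsHypothesis.ValiantsHypothesis.Theses.FifoMatching.NFPolytopeQuasiPolyXC :=
  newtXC_of_faceProjection_of_AboulkerEtAl2019 NFPolytopeQuasiPolyXC.QueueGridFace.queueGridFaceProjection hyp

end Summit.ValiantsHypothesis.ValiantsHypothesis.Theorems.FifoMatching.QueueGridFace
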